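import Mathlib.RingTheory.MvPolynomial.WeightedHomogeneous
import Mathlib.Algebra.MvPolynomial.CommRing
import HarnessLib

/-!
# The graded leading-form principle for substitutions (instrument, NOT a resolution theorem)

Engine 1 of the RESOLUTION OBSERVATORY toy model `W(f)` — generic two-gradings bookkeeping behind RE-DERIVATION-eng1-g41 §3.7.6 (5₃)
"THE DIAGONAL IDENTITY" (CARVER-NOTES-eng1-g41 T98: "for an automorphism whose replacement terms all have Z-degree ≥ parameter-degree, the
(Z-degree = parameter-degree)-component of `Φ(g) − g` equals `Ψ(ḡ) − ḡ` for the diagonal part `Ψ`") and behind the vertex step of LEMMA L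
(`WeightedCentreVertexStep`, the case of variable-weights `0`).

Setting: a substitution `x_j ↦ a_j + b_j` into `MvPolynomial σ K`, weighted by `wt : σ → M` (`M` a linearly ordered abelian group), where
the LEADING part `a_j` is `wt`-homogeneous of weight `w j` — the weight given to the variable `x_j` — and the TAIL `b_j` has only monomials
of weight `> w j`.  Then for `P` `w`-homogeneous of weight `n`:
* `aeval a P` is `wt`-homogeneous of weight `n` (`isWeightedHomogeneous_aeval`);
* `aeval (a + b) P − aeval a P` has only monomials of weight `> n` (`wtGT_aeval_sub_aeval`);
* hence the weight-`n` component of `P(a + b)` is `P(a)` (`weightedHomogeneousComponent_aeval`), and for a general `P` whose monomials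
  weigh `≥ n` it is `P_n(a)` with `P_n` the weight-`n` part of `P` (`weightedHomogeneousComponent_aeval_of_wtGE`) — the diagonal identity
  with `wt = (Z-degree) − (parameter-degree)`, `a` = variable + diagonal replacement terms, `b` = the terms above the diagonal.
Classical graded-algebra bookkeeping (leading forms of products are products of leading forms) [Lang2002, Ch. IV §1; Matsumura1987, §27];
statements OURS in this packaging.
-/

namespace Literature.AlgebraicGeometry.Resolution.WeightedBlowup

namespace LeadingForm

open MvPolynomial
open scoped Pointwise

variable {K : Type*} [CommRing K] {σ : Type*} {M : Type*} [AddCommGroup M] [LinearOrder M]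

/-! ## Lower weight bounds on supports -/

section Bounds

variable (wt : σ → M)

/-- Every monomial of `f` has `wt`-weight `≥ n` (ours, bookkeeping predicate). [cite: Lang2002, Ch. IV §1] -/
def WtGE (n : M) (f : MvPolynomial σ K) : Prop := ∀ m ∈ f.support, n ≤ Finsupp.weight wt m

/-- Every monomial of `f` has `wt`-weight `> n` (ours, bookkeeping predicate). [cite: Lang2002, Ch. IV §1] -/
def WtGT (n : M) (f : MvPolynomial σ K) : Prop := ∀ m ∈ f.support, n < Finsupp.weight wt m

variable {wt}

/-- Homogeneous of weight `n` ⇒ weights `≥ n` (ours, bookkeeping). [cite: Lang2002, Ch. IV §1] -/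
theorem wtGE_of_isWeightedHomogeneous {n : M} {f : MvPolynomial σ K} (h : IsWeightedHomogeneous wt f n) : WtGE wt n f :=
  fun _ hm => (h (mem_support_iff.mp hm)).symm.le

/-- `> n` ⇒ `≥ n` (ours, bookkeeping). [cite: Lang2002, Ch. IV §1] -/
theorem WtGT.wtGE {n : M} {f : MvPolynomial σ K} (h : WtGT wt n f) : WtGE wt n f := fun m hm => (h m hm).le

/-- `≥ n` and `k < n` ⇒ `> k` (ours, bookkeeping). [cite: Lang2002, Ch. IV §1] -/
theorem WtGE.wtGT_of_lt {n k : M} {f : MvPolynomial σ K} (h : WtGE wt n f) (hkn : k < n) : WtGT wt k f :=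
  fun m hm => hkn.trans_le (h m hm)

/-- `0` has no monomials (ours, bookkeeping). [cite: Lang2002, Ch. IV §1] -/
theorem wtGT_zero (n : M) : WtGT wt n (0 : MvPolynomial σ K) := fun m hm => by simp at hm

/-- `0` has no monomials (ours, bookkeeping). [cite: Lang2002, Ch. IV §1] -/
theorem wtGE_zero (n : M) : WtGE wt n (0 : MvPolynomial σ K) := fun m hm => by simp at hm

/-- Constants weigh `0` (ours, bookkeeping). [cite: Lang2002, Ch. IV §1] -/
theorem wtGE_C (c : K) : WtGE wt 0 (C c : MvPolynomial σ K) := by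
  classical
  intro m hm
  rw [mem_support_iff, coeff_C] at hm
  split_ifs at hm with h
  · subst h; simp
  · exact absurd rfl hm

/-- `1` weighs `0` (ours, bookkeeping). [cite: Lang2002, Ch. IV §1] -/
theorem wtGE_one : WtGE wt 0 (1 : MvPolynomial σ K) := by
  rw [← C_1]; exact wtGE_C 1

variable [DecidableEq σ]

/-- Stability under `+` (ours, bookkeeping). [cite: Lang2002, Ch. IV §1] -/
theorem WtGE.add {n : M} {f g : MvPolynomial σ K} (hf : WtGE wt n f) (hg : WtGE wt n g) : WtGE wt n (f + g) := by
  intro m hm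
  rcases Finset.mem_union.mp (support_add hm) with h | h
  exacts [hf m h, hg m h]

/-- Stability under `+` (ours, bookkeeping). [cite: Lang2002, Ch. IV §1] -/
theorem WtGT.add {n : M} {f g : MvPolynomial σ K} (hf : WtGT wt n f) (hg : WtGT wt n g) : WtGT wt n (f + g) := by
  intro m hm
  rcases Finset.mem_union.mp (support_add hm) with h | h
  exacts [hf m h, hg m h]

/-- Stability under finite sums (ours, bookkeeping). [cite: Lang2002, Ch. IV §1] -/
theorem WtGT.sum {ι : Type*} {n : M} (s : Finset ι) (F : ι → MvPolynomial σ K) (h : ∀ i ∈ s, WtGT wt n (F i)) :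
    WtGT wt n (∑ i ∈ s, F i) :=
  Finset.sum_induction F (WtGT wt n) (fun _ _ => WtGT.add) (wtGT_zero n) h

variable [IsOrderedAddMonoid M]

/-- Weights add under `*`: `≥ u` times `≥ u'` is `≥ u + u'` (ours). [cite: Lang2002, Ch. IV §1] -/
theorem WtGE.mul {u u' : M} {f g : MvPolynomial σ K} (hf : WtGE wt u f) (hg : WtGE wt u' g) : WtGE wt (u + u') (f * g) := by
  intro m hm
  obtain ⟨a, ha, b, hb, rfl⟩ := Finset.mem_add.mp (support_mul f g hm)
  rw [map_add]
  exact add_le_add (hf a ha) (hg b hb)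

/-- `≥ u` times `> u'` is `> u + u'` (ours). [cite: Lang2002, Ch. IV §1] -/
theorem WtGE.mul_wtGT {u u' : M} {f g : MvPolynomial σ K} (hf : WtGE wt u f) (hg : WtGT wt u' g) :
    WtGT wt (u + u') (f * g) := by
  intro m hm
  obtain ⟨a, ha, b, hb, rfl⟩ := Finset.mem_add.mp (support_mul f g hm)
  rw [map_add]
  exact add_lt_add_of_le_of_lt (hf a ha) (hg b hb)

/-- `> u` times `≥ u'` is `> u + u'` (ours). [cite: Lang2002, Ch. IV §1] -/
theorem WtGT.mul_wtGE {u u' : M} {f g : MvPolynomial σ K} (hf : WtGT wt u f) (hg : WtGE wt u' g) :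
    WtGT wt (u + u') (f * g) := by
  intro m hm
  obtain ⟨a, ha, b, hb, rfl⟩ := Finset.mem_add.mp (support_mul f g hm)
  rw [map_add]
  exact add_lt_add_of_lt_of_le (hf a ha) (hg b hb)

/-- A constant multiple keeps `> n` (ours, bookkeeping). [cite: Lang2002, Ch. IV §1] -/
theorem WtGT.C_mul {n : M} {f : MvPolynomial σ K} (hf : WtGT wt n f) (c : K) : WtGT wt n (C c * f) := by
  have h := (wtGE_C (wt := wt) c).mul_wtGT hf
  rwa [zero_add] at h

/-- Products: `≥ u i` factors give `≥ Σ u i` (ours). [cite: Lang2002, Ch. IV §1] -/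
theorem WtGE.prod {ι : Type*} (s : Finset ι) (F : ι → MvPolynomial σ K) (u : ι → M) (h : ∀ i ∈ s, WtGE wt (u i) (F i)) :
    WtGE wt (∑ i ∈ s, u i) (∏ i ∈ s, F i) := by
  classical
  induction s using Finset.induction_on with
  | empty => simpa using (wtGE_one (wt := wt) (K := K))
  | insert i s hi ih =>
    rw [Finset.prod_insert hi, Finset.sum_insert hi]
    exact (h i (Finset.mem_insert_self _ _)).mul (ih fun j hj => h j (Finset.mem_insert_of_mem hj))

/-- Powers: `≥ u` gives `≥ e • u` (ours). [cite: Lang2002, Ch. IV §1] -/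
theorem WtGE.pow {u : M} {f : MvPolynomial σ K} (hf : WtGE wt u f) (e : ℕ) : WtGE wt (e • u) (f ^ e) := by
  have h := WtGE.prod (Finset.range e) (fun _ => f) (fun _ => u) fun _ _ => hf
  simpa only [Finset.prod_const, Finset.card_range, Finset.sum_const] using h

end Bounds

/-! ## Leading forms of products -/

section Leading

variable [IsOrderedAddMonoid M] {wt : σ → M} [DecidableEq σ]

/-- **Leading form of a product** (ours): `(A + B)(A′ + B′) − AA′` weighs `> u + u′` when `A`, `A′` are homogeneous of weights `u`, `u′`
and the tails `B`, `B′` weigh `> u`, `> u′`. [cite: Lang2002, Ch. IV §1] -/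
theorem mul_leading {A B A' B' : MvPolynomial σ K} {u u' : M} (hA : IsWeightedHomogeneous wt A u) (hB : WtGT wt u B)
    (hA' : IsWeightedHomogeneous wt A' u') (hB' : WtGT wt u' B') :
    WtGT wt (u + u') ((A + B) * (A' + B') - A * A') := by
  have e : (A + B) * (A' + B') - A * A' = A * B' + B * (A' + B') := by ring
  rw [e]
  exact ((wtGE_of_isWeightedHomogeneous hA).mul_wtGT hB').add
    (hB.mul_wtGE ((wtGE_of_isWeightedHomogeneous hA').add hB'.wtGE))

/-- **Leading form of a finite product** (ours): `Π (A i + B i) − Π A i` weighs `> Σ u i`. [cite: Lang2002, Ch. IV §1] -/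
theorem prod_leading {ι : Type*} (s : Finset ι) (A B : ι → MvPolynomial σ K) (u : ι → M)
    (hA : ∀ i ∈ s, IsWeightedHomogeneous wt (A i) (u i)) (hB : ∀ i ∈ s, WtGT wt (u i) (B i)) :
    WtGT wt (∑ i ∈ s, u i) (∏ i ∈ s, (A i + B i) - ∏ i ∈ s, A i) := by
  classical
  induction s using Finset.induction_on with
  | empty => simpa using wtGT_zero (wt := wt) (K := K) (0 : M)
  | insert i s hi ih =>
    rw [Finset.prod_insert hi, Finset.prod_insert hi, Finset.sum_insert hi]
    have hP : IsWeightedHomogeneous wt (∏ j ∈ s, A j) (∑ j ∈ s, u j) :=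
      IsWeightedHomogeneous.prod s A u fun j hj => hA j (Finset.mem_insert_of_mem hj)
    have hR := ih (fun j hj => hA j (Finset.mem_insert_of_mem hj)) (fun j hj => hB j (Finset.mem_insert_of_mem hj))
    have e : (A i + B i) * ∏ j ∈ s, (A j + B j) - A i * ∏ j ∈ s, A j
        = (A i + B i) * (∏ j ∈ s, A j + (∏ j ∈ s, (A j + B j) - ∏ j ∈ s, A j)) - A i * ∏ j ∈ s, A j := by ring
    rw [e]
    exact mul_leading (hA i (Finset.mem_insert_self _ _)) (hB i (Finset.mem_insert_self _ _)) hP hR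

/-- **Leading form of a power** (ours): `(A + B)^e − A^e` weighs `> e • u`. [cite: Lang2002, Ch. IV §1] -/
theorem pow_leading {A B : MvPolynomial σ K} {u : M} (hA : IsWeightedHomogeneous wt A u) (hB : WtGT wt u B) (e : ℕ) :
    WtGT wt (e • u) ((A + B) ^ e - A ^ e) := by
  have h := prod_leading (Finset.range e) (fun _ => A) (fun _ => B) (fun _ => u) (fun _ _ => hA) (fun _ _ => hB)
  simpa only [Finset.prod_const, Finset.card_range, Finset.sum_const] using h

end Leading

/-! ## Substitutions: leading part + tail -/

section Substitution

variable [IsOrderedAddMonoid M] {wt : σ → M} [DecidableEq σ] {τ : Type*} {w : τ → M} {a b : τ → MvPolynomial σ K}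

omit [LinearOrder M] [IsOrderedAddMonoid M] [DecidableEq σ] in
/-- **`P(a)` is homogeneous of weight `n`** (ours) when `a_j` is homogeneous of the weight `w j` of the variable `x_j` and `P` is
`w`-homogeneous of weight `n`. [cite: Lang2002, Ch. IV §1] -/
theorem isWeightedHomogeneous_aeval (ha : ∀ j, IsWeightedHomogeneous wt (a j) (w j)) {P : MvPolynomial τ K} {n : M}
    (hP : IsWeightedHomogeneous w P n) : IsWeightedHomogeneous wt (aeval a P) n := by
  classical
  rw [P.as_sum, map_sum]
  refine IsWeightedHomogeneous.sum _ _ _ fun m hm => ?_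
  rw [aeval_monomial, MvPolynomial.algebraMap_eq, ← hP (mem_support_iff.mp hm), Finsupp.weight_apply, Finsupp.sum,
    Finsupp.prod]
  exact (IsWeightedHomogeneous.prod _ _ _ fun i _ => (ha i).pow (m i)).C_mul _

/-- The substitution `a + b` sends a monomial of `w`-weight `u` to weights `≥ u` (ours). [cite: Lang2002, Ch. IV §1] -/
theorem wtGE_aeval_monomial (ha : ∀ j, IsWeightedHomogeneous wt (a j) (w j)) (hb : ∀ j, WtGT wt (w j) (b j))
    (m : τ →₀ ℕ) (c : K) : WtGE wt (Finsupp.weight w m) (aeval (fun j => a j + b j) (monomial m c)) := by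
  rw [aeval_monomial, MvPolynomial.algebraMap_eq, Finsupp.weight_apply, Finsupp.sum, Finsupp.prod]
  have h := (wtGE_C (wt := wt) c).mul (WtGE.prod m.support (fun i => (a i + b i) ^ (m i)) (fun i => m i • w i)
    fun i _ => ((wtGE_of_isWeightedHomogeneous (ha i)).add (hb i).wtGE).pow (m i))
  rwa [zero_add] at h

/-- If every monomial of `Q` weighs `> n`, so does `Q(a + b)` (ours). [cite: Lang2002, Ch. IV §1] -/
theorem wtGT_aeval (ha : ∀ j, IsWeightedHomogeneous wt (a j) (w j)) (hb : ∀ j, WtGT wt (w j) (b j)) {Q : MvPolynomial τ K}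
    {n : M} (hQ : WtGT w n Q) : WtGT wt n (aeval (fun j => a j + b j) Q) := by
  classical
  rw [Q.as_sum, map_sum]
  exact WtGT.sum _ _ fun m hm => (wtGE_aeval_monomial ha hb m _).wtGT_of_lt (hQ m hm)

/-- **The tail of `P(a + b)`** (ours): for `P` `w`-homogeneous of weight `n`, `P(a + b) − P(a)` weighs `> n`.
[cite: Lang2002, Ch. IV §1; Matsumura1987, §27 (p. 207)] -/
theorem wtGT_aeval_sub_aeval (ha : ∀ j, IsWeightedHomogeneous wt (a j) (w j)) (hb : ∀ j, WtGT wt (w j) (b j))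
    {P : MvPolynomial τ K} {n : M} (hP : IsWeightedHomogeneous w P n) :
    WtGT wt n (aeval (fun j => a j + b j) P - aeval a P) := by
  classical
  have e : aeval (fun j => a j + b j) P - aeval a P
      = ∑ m ∈ P.support, (aeval (fun j => a j + b j) (monomial m (coeff m P)) - aeval a (monomial m (coeff m P))) := by
    conv_lhs => rw [P.as_sum]
    rw [map_sum, map_sum, ← Finset.sum_sub_distrib]
  rw [e]
  refine WtGT.sum _ _ fun m hm => ?_
  rw [← hP (mem_support_iff.mp hm), aeval_monomial, aeval_monomial, MvPolynomial.algebraMap_eq, ← mul_sub,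
    Finsupp.weight_apply, Finsupp.sum, Finsupp.prod, Finsupp.prod]
  have h := prod_leading (wt := wt) m.support (fun i => a i ^ (m i)) (fun i => (a i + b i) ^ (m i) - a i ^ (m i))
    (fun i => m i • w i) (fun i _ => (ha i).pow (m i)) (fun i _ => pow_leading (ha i) (hb i) (m i))
  simp only [add_sub_cancel] at h
  exact h.C_mul _

/-- **THE LEADING-FORM PRINCIPLE** (ours): for `P` `w`-homogeneous of weight `n`, the weight-`n` component of `P(a + b)` is `P(a)`.
[cite: Lang2002, Ch. IV §1; Matsumura1987, §27 (p. 207)] -/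
theorem weightedHomogeneousComponent_aeval (ha : ∀ j, IsWeightedHomogeneous wt (a j) (w j)) (hb : ∀ j, WtGT wt (w j) (b j))
    {P : MvPolynomial τ K} {n : M} (hP : IsWeightedHomogeneous w P n) :
    weightedHomogeneousComponent wt n (aeval (fun j => a j + b j) P) = aeval a P := by
  have hsplit : aeval (fun j => a j + b j) P = aeval a P + (aeval (fun j => a j + b j) P - aeval a P) := by ring
  rw [hsplit, map_add, (isWeightedHomogeneous_aeval ha hP).weightedHomogeneousComponent_same,
    weightedHomogeneousComponent_eq_zero' n _ (fun d hd => (wtGT_aeval_sub_aeval ha hb hP d hd).ne'), add_zero]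

/-- **THE DIAGONAL IDENTITY** (ours; T98's reusable ingredient): if every monomial of `P` weighs `≥ n`, the weight-`n` component of
`P(a + b)` is `P_n(a)`, `P_n` the weight-`n` component of `P`. [cite: Lang2002, Ch. IV §1; Matsumura1987, §27 (p. 207)] -/
theorem weightedHomogeneousComponent_aeval_of_wtGE (ha : ∀ j, IsWeightedHomogeneous wt (a j) (w j))
    (hb : ∀ j, WtGT wt (w j) (b j)) {P : MvPolynomial τ K} {n : M} (hP : WtGE w n P) :
    weightedHomogeneousComponent wt n (aeval (fun j => a j + b j) P)
      = aeval a (weightedHomogeneousComponent w n P) := by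
  classical
  set Pn := weightedHomogeneousComponent w n P with hPn_def
  have hPn : IsWeightedHomogeneous w Pn n := weightedHomogeneousComponent_isWeightedHomogeneous n P
  have hQ : WtGT w n (P - Pn) := by
    intro m hm
    have hc : coeff m (P - Pn) ≠ 0 := mem_support_iff.mp hm
    rw [coeff_sub, hPn_def, coeff_weightedHomogeneousComponent] at hc
    by_cases h : Finsupp.weight w m = n
    · rw [if_pos h, sub_self] at hc
      exact absurd rfl hc
    · rw [if_neg h, sub_zero] at hc
      exact lt_of_le_of_ne (hP m (mem_support_iff.mpr hc)) (Ne.symm h)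
  have e : P = Pn + (P - Pn) := by ring
  conv_lhs => rw [e]
  rw [map_add, map_add, weightedHomogeneousComponent_aeval ha hb hPn,
    weightedHomogeneousComponent_eq_zero' n _ (fun d hd => (wtGT_aeval ha hb hQ d hd).ne'), add_zero]

/-- The difference form (ours): the weight-`n` component of `P(a + b) − P_n` … stated as the engine uses it — the weight-`n` component of
`P(a + b) − P` is `P_n(a) − P_n` whenever, in addition, `wt`- and `w`-weights live on the same monomials (`σ = τ`, `wt = w`).
[cite: Lang2002, Ch. IV §1] -/
theorem weightedHomogeneousComponent_aeval_sub_self {w : σ → M} {a b : σ → MvPolynomial σ K}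
    (ha : ∀ j, IsWeightedHomogeneous w (a j) (w j)) (hb : ∀ j, WtGT w (w j) (b j)) {P : MvPolynomial σ K} {n : M}
    (hP : WtGE w n P) :
    weightedHomogeneousComponent w n (aeval (fun j => a j + b j) P - P)
      = aeval a (weightedHomogeneousComponent w n P) - weightedHomogeneousComponent w n P := by
  rw [map_sub, weightedHomogeneousComponent_aeval_of_wtGE ha hb hP]

end Substitution

/-! ## Smoke test -/

section Test

/-- Over `ℤ`, variables `Fin 2` with weights `w 0 = 0`, `w 1 = 1` (`x₁` plays "ε_Z"): the substitution `x₀ ↦ x₀ + x₁²` (leading part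
`x₀` of weight `0`, tail `x₁²` of weight `2 > 0`), `x₁ ↦ x₁`; for `P = x₀·x₁` (homogeneous of weight `1`) the weight-`1` component of
`P(a + b) = x₀x₁ + x₁³` is `P(a) = x₀x₁`. -/
example : weightedHomogeneousComponent (fun i : Fin 2 => if i = 0 then (0 : ℤ) else 1) 1
    (aeval (fun j : Fin 2 => (if j = 0 then X 0 else X 1 : MvPolynomial (Fin 2) ℤ) + (if j = 0 then X 1 ^ 2 else 0))
      (X 0 * X 1 : MvPolynomial (Fin 2) ℤ))
      = X 0 * X 1 := by
  classical
  have h := weightedHomogeneousComponent_aeval (K := ℤ) (wt := fun i : Fin 2 => if i = 0 then (0 : ℤ) else 1)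
    (w := fun i : Fin 2 => if i = 0 then (0 : ℤ) else 1) (a := fun j => if j = 0 then X 0 else X 1)
    (b := fun j => if j = 0 then X 1 ^ 2 else 0) ?_ ?_ (P := X 0 * X 1) (n := 1) ?_
  · rw [h, map_mul, aeval_X, aeval_X]; simp
  · intro j
    fin_cases j
    · simpa using isWeightedHomogeneous_X (R := ℤ) (fun i : Fin 2 => if i = 0 then (0 : ℤ) else 1) 0
    · simpa using isWeightedHomogeneous_X (R := ℤ) (fun i : Fin 2 => if i = 0 then (0 : ℤ) else 1) 1
  · intro j
    fin_cases j
    · intro m hm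
      simp only [Fin.zero_eta, Fin.isValue, ↓reduceIte] at hm
      rw [X_pow_eq_monomial, support_monomial, if_neg one_ne_zero, Finset.mem_singleton] at hm
      subst hm
      simp [Finsupp.weight_apply]
    · simpa using wtGT_zero (K := ℤ) (wt := fun i : Fin 2 => if i = 0 then (0 : ℤ) else 1) (1 : ℤ)
  · have h1 := (isWeightedHomogeneous_X (R := ℤ) (fun i : Fin 2 => if i = 0 then (0 : ℤ) else 1) 0).mul
      (isWeightedHomogeneous_X (R := ℤ) (fun i : Fin 2 => if i = 0 then (0 : ℤ) else 1) 1)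
    simpa using h1

end Test

end LeadingForm

end Literature.AlgebraicGeometry.Resolution.WeightedBlowup
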